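import Literature.Analysis.DeBrangesSpaces.HalfPlaneCauchy
import Mathlib.Analysis.SpecialFunctions.Integrals.LogTrigonometric
import Mathlib.Analysis.SpecialFunctions.Complex.LogBounds
import Mathlib.MeasureTheory.Function.JacobianOneDim
import Mathlib.Analysis.SpecialFunctions.JapaneseBracket
import HarnessLib

/-!
# The Poisson integral of `log|t − a|` over the real line

For `z = x + iy` in the open upper half-plane and `a` in the open lower half-plane,

  `(y/π) ∫_ℝ log|t − a| dt/((t − x)² + y²) = log|z − a|`

(`integral_log_norm_sub_div`): the harmonic function `log|· − a|` on the upper half-plane is the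
Poisson integral of its boundary values — the half-plane form of the statement that `log|Q|` is
the Poisson integral of `log|Q|` on the boundary for the outer function `Q(z) = z − a` (Rudin,
*Real and Complex Analysis*, Thm 17.16(a), for the disc). This is the computation behind the
membership of the kernel functions `K(w, ·)` in Conrey–Li's spaces `𝓕(W)` (the Poisson log-majorant
clause of `Literature.Analysis.DeBrangesSpaces.SpaceF.Mem`, file `ConreyLi2000SpacesFW.lean`), used
in `ConreyLi2000SpacesFWProofs.lean`.

## Proof (classical; Cauchy's formula instead of harmonic-function theory)

* `integral_log_one_add_sq_div`: `∫_ℝ log(1+s²) ds/(1+s²) = 2π log 2` — the substitution `s = tan θ`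
  turns it into `−2∫_{−π/2}^{π/2} log cos θ dθ = −2∫₀^π log sin = 2π log 2` (Mathlib's
  `integral_log_sin_zero_pi`; this is the real-line form of Rudin's Lemma 15.17,
  `∫ log|1 − e^{iθ}| dθ = 0`).
* `integral_log_norm_sub_conj_div`: for `a = z̄` the integrand is `½ log((t−x)²+y²)/((t−x)²+y²)`,
  and scaling gives `(π/y) log(2y)`.
* `integral_log_norm_sub_sub_div` (one step): for `b, c` in the lower half-plane with
  `|c − b| ≤ |Im c|/2`, the function `F(w) = log(1 + (c−b)/(w−c)) = log((w−b)/(w−c))` is holomorphic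
  on the closed upper half-plane with `|F| ≤ (3/2)|c−b|/|w−c|`, so the tree's half-plane Cauchy
  lemmas (`integral_div_sub_eq_of_im_pos`, `integral_div_sub_eq_zero_of_im_neg`, file
  `HalfPlaneCauchy.lean`) give `∫ F(t)[1/(t−z) − 1/(t−z̄)] dt = 2πi F(z)`, i.e.
  `∫ F(t) dt/((t−x)²+y²) = (π/y) F(z)`; real parts give the difference formula for
  `log|t−b| − log|t−c|`.
* `integral_log_norm_sub_div`: chain the one-step formula along the segment from `a` to `z̄`
  (finitely many steps of length `≤ min(|Im a|, y)/2`) and add the `a = z̄` evaluation.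

## References

* [Rudin1987] W. Rudin, *Real and Complex Analysis*, 3rd ed.: Lemma 15.17 (`∫ log|1−e^{iθ}| = 0`),
  Definition 17.14 and Theorem 17.16(a) (outer functions: `log|Q|` is the Poisson integral of
  `log φ`) — disc forms of the statements proved here for the half-plane (read: PDF pp. 253–254,
  282–283 of the held copy).
* [ConreyLi2000] J. B. Conrey, X.-J. Li, IMRN 2000:18 = arXiv:math/9812166, §2 (the membership
  inequality of `𝓕(W)`).
-/

noncomputable section

open scoped Real Topology ComplexConjugate
open _root_.Complex _root_.MeasureTheory _root_.Filter _root_.Set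

namespace Literature.Analysis.DeBrangesSpaces

/-! ### `∫ log(1+s²)/(1+s²) = 2π log 2` -/

/-- **`∫_ℝ log(1 + s²)/(1 + s²) ds = 2π log 2`** (substitute `s = tan θ`:
`−2∫_{−π/2}^{π/2} log cos θ dθ = −2 ∫₀^π log sin = 2π log 2`). The real-line form of
`(1/2π)∫₀^{2π} log|1 − e^{iθ}| dθ = 0`. [cite: Rudin1987, Lemma 15.17] -/
theorem integral_log_one_add_sq_div :
    ∫ s : ℝ, Real.log (1 + s ^ 2) / (1 + s ^ 2) = 2 * π * Real.log 2 := by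
  have hderiv : ∀ θ ∈ Ioo (-(π / 2)) (π / 2),
      HasDerivWithinAt Real.tan (1 / Real.cos θ ^ 2) (Ioo (-(π / 2)) (π / 2)) θ :=
    fun θ hθ ↦ (Real.hasDerivAt_tan (Real.cos_pos_of_mem_Ioo hθ).ne').hasDerivWithinAt
  have hcv := integral_image_eq_integral_abs_deriv_smul measurableSet_Ioo hderiv Real.injOn_tan
    (fun s : ℝ ↦ Real.log (1 + s ^ 2) / (1 + s ^ 2))
  rw [Real.image_tan_Ioo, setIntegral_univ] at hcv
  rw [hcv]
  have heq : EqOn (fun θ : ℝ ↦ |1 / Real.cos θ ^ 2| •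
        (Real.log (1 + Real.tan θ ^ 2) / (1 + Real.tan θ ^ 2)))
      (fun θ ↦ -2 * Real.log (Real.cos θ)) (Ioo (-(π / 2)) (π / 2)) := by
    intro θ hθ
    have hc : 0 < Real.cos θ := Real.cos_pos_of_mem_Ioo hθ
    have h1 : 1 + Real.tan θ ^ 2 = (Real.cos θ ^ 2)⁻¹ := by
      rw [← Real.inv_one_add_tan_sq hc.ne', inv_inv]
    simp only [smul_eq_mul]
    rw [h1, Real.log_inv, Real.log_pow, abs_of_pos (by positivity)]
    field_simp
    push_cast
    ring
  rw [setIntegral_congr_fun measurableSet_Ioo heq, ← integral_Ioc_eq_integral_Ioo,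
    ← intervalIntegral.integral_of_le (by linarith [Real.pi_pos]),
    intervalIntegral.integral_const_mul]
  have hcos : ∫ θ in (-(π / 2))..(π / 2), Real.log (Real.cos θ) = -Real.log 2 * π := by
    have h := intervalIntegral.integral_comp_add_right (a := -(π / 2)) (b := π / 2)
      (fun θ : ℝ ↦ Real.log (Real.sin θ)) (π / 2)
    simp only [Real.sin_add_pi_div_two] at h
    rw [h, show -(π / 2) + π / 2 = 0 by ring, show π / 2 + π / 2 = π by ring]
    exact integral_log_sin_zero_pi
  rw [hcos]
  ring

/-! ### Integrability of `log|t − a| / ((t − x)² + y²)` -/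

/-- `log u ≤ 2√u` for `u > 0` (from `log √u ≤ √u − 1`). [folklore] -/
private theorem log_le_two_mul_sqrt {u : ℝ} (hu : 0 < u) : Real.log u ≤ 2 * Real.sqrt u := by
  have h := Real.log_le_sub_one_of_pos (Real.sqrt_pos.2 hu)
  rw [Real.log_sqrt hu.le] at h
  linarith [Real.sqrt_nonneg u]

/-- For real `t` and non-real `a`, with `m = |Im a|`:
`|log|t − a|| ≤ |log m| + (2/√m) √(1 + |x − a|) √(1 + |t − x|)` (square-root growth in `t`).
[folklore] -/
private theorem abs_log_norm_sub_le {a : ℂ} (ha : a.im ≠ 0) (x t : ℝ) :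
    |Real.log ‖(t : ℂ) - a‖| ≤ abs (Real.log (abs a.im))
      + 2 / Real.sqrt (abs a.im) * Real.sqrt (1 + ‖(x : ℂ) - a‖) * Real.sqrt (1 + |t - x|) := by
  set m : ℝ := abs a.im with hm
  have hm0 : 0 < m := abs_pos.2 ha
  have hsm : 0 < Real.sqrt m := Real.sqrt_pos.2 hm0
  have hnorm : m ≤ ‖(t : ℂ) - a‖ := abs_im_le_norm_ofReal_sub t a
  have hpos : 0 < ‖(t : ℂ) - a‖ := hm0.trans_le hnorm
  -- `log m ≤ log|t-a| ≤ log m + 2 √(|t-a|/m)`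
  have hlow : Real.log m ≤ Real.log ‖(t : ℂ) - a‖ := Real.log_le_log hm0 hnorm
  have hup : Real.log ‖(t : ℂ) - a‖ ≤ Real.log m + 2 * Real.sqrt (‖(t : ℂ) - a‖ / m) := by
    have h := log_le_two_mul_sqrt (div_pos hpos hm0)
    rw [Real.log_div hpos.ne' hm0.ne'] at h
    linarith
  -- `√(|t-a|/m) ≤ √(1+|x-a|) √(1+|t-x|) / √m`
  have htri : ‖(t : ℂ) - a‖ ≤ (1 + ‖(x : ℂ) - a‖) * (1 + |t - x|) := by
    have h1 : ‖(t : ℂ) - a‖ ≤ ‖(t : ℂ) - x‖ + ‖(x : ℂ) - a‖ := norm_sub_le_norm_sub_add_norm_sub _ _ _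
    have h2 : ‖(t : ℂ) - x‖ = |t - x| := by
      rw [← Complex.ofReal_sub, Complex.norm_real, Real.norm_eq_abs]
    rw [h2] at h1
    nlinarith [abs_nonneg (t - x), norm_nonneg ((x : ℂ) - a)]
  have hsq : Real.sqrt (‖(t : ℂ) - a‖ / m)
      ≤ Real.sqrt (1 + ‖(x : ℂ) - a‖) * Real.sqrt (1 + |t - x|) / Real.sqrt m := by
    rw [Real.sqrt_div' _ hm0.le, ← Real.sqrt_mul (by positivity)]
    exact div_le_div_of_nonneg_right (Real.sqrt_le_sqrt htri) hsm.le
  have h3 : 2 * Real.sqrt (‖(t : ℂ) - a‖ / m)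
      ≤ 2 / Real.sqrt m * Real.sqrt (1 + ‖(x : ℂ) - a‖) * Real.sqrt (1 + |t - x|) := by
    calc 2 * Real.sqrt (‖(t : ℂ) - a‖ / m)
        ≤ 2 * (Real.sqrt (1 + ‖(x : ℂ) - a‖) * Real.sqrt (1 + |t - x|) / Real.sqrt m) :=
          mul_le_mul_of_nonneg_left hsq (by norm_num)
      _ = 2 / Real.sqrt m * Real.sqrt (1 + ‖(x : ℂ) - a‖) * Real.sqrt (1 + |t - x|) := by
          field_simp
  have h0 : 0 ≤ 2 / Real.sqrt m * Real.sqrt (1 + ‖(x : ℂ) - a‖) * Real.sqrt (1 + |t - x|) := by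
    positivity
  rw [abs_le]
  constructor
  · linarith [neg_abs_le (Real.log m)]
  · linarith [le_abs_self (Real.log m)]

/-- **Integrability**: for non-real `a` and `y ≠ 0`, `t ↦ log|t − a| / ((t − x)² + y²)` is
integrable on `ℝ` (the integrand is `O(|t|^{−3/2})`). [cite: Rudin1987, Thm 17.16 (half-plane form)] -/
theorem integrable_log_norm_sub_div {a : ℂ} (ha : a.im ≠ 0) (x : ℝ) {y : ℝ} (hy : y ≠ 0) :
    Integrable fun t : ℝ ↦ Real.log ‖(t : ℂ) - a‖ / ((t - x) ^ 2 + y ^ 2) := by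
  -- constants
  set A : ℝ := abs (Real.log (abs a.im))
    + 2 / Real.sqrt (abs a.im) * Real.sqrt (1 + ‖(x : ℂ) - a‖) with hA
  have hA0 : 0 ≤ A := by positivity
  set c : ℝ := min 1 (y ^ 2) / 2 with hc
  have hc0 : 0 < c := by
    have : 0 < min 1 (y ^ 2) := lt_min one_pos (by positivity)
    rw [hc]; linarith
  -- the dominating function `(A / c) (1 + |t - x|)^{-3/2}`
  have hdom : Integrable fun t : ℝ ↦ A / c * (1 + ‖t - x‖) ^ (-(3 / 2 : ℝ)) := by
    have h := (integrable_one_add_norm (E := ℝ) (μ := volume) (r := 3 / 2)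
      (by rw [Module.finrank_self]; norm_num)).comp_sub_right x
    exact h.const_mul _
  have hne : ∀ t : ℝ, (t - x) ^ 2 + y ^ 2 ≠ 0 := fun t ↦ by positivity
  have hnorm_ne : ∀ t : ℝ, ‖(t : ℂ) - a‖ ≠ 0 := fun t ↦
    ((abs_pos.2 ha).trans_le (abs_im_le_norm_ofReal_sub t a)).ne'
  have hcont : Continuous fun t : ℝ ↦ Real.log ‖(t : ℂ) - a‖ / ((t - x) ^ 2 + y ^ 2) := by
    refine Continuous.div ?_ (by fun_prop) hne
    exact ((Complex.continuous_ofReal.sub continuous_const).norm).log hnorm_ne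
  refine hdom.mono' hcont.aestronglyMeasurable (ae_of_all _ fun t ↦ ?_)
  rw [Real.norm_eq_abs, abs_div, abs_of_pos (by positivity : 0 < (t - x) ^ 2 + y ^ 2)]
  -- numerator bound
  have hnum : |Real.log ‖(t : ℂ) - a‖| ≤ A * Real.sqrt (1 + |t - x|) := by
    have h := abs_log_norm_sub_le ha x t
    have h1 : 1 ≤ Real.sqrt (1 + |t - x|) := by
      calc (1 : ℝ) = Real.sqrt 1 := Real.sqrt_one.symm
        _ ≤ Real.sqrt (1 + |t - x|) := Real.sqrt_le_sqrt (by linarith [abs_nonneg (t - x)])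
    have h2 : abs (Real.log (abs a.im))
        ≤ abs (Real.log (abs a.im)) * Real.sqrt (1 + |t - x|) :=
      le_mul_of_one_le_right (abs_nonneg _) h1
    rw [hA]
    nlinarith
  -- denominator bound: `c (1 + |t - x|)² ≤ (t - x)² + y²`
  have hden : c * (1 + |t - x|) ^ 2 ≤ (t - x) ^ 2 + y ^ 2 := by
    have hmin1 : min 1 (y ^ 2) ≤ 1 := min_le_left _ _
    have hmin2 : min 1 (y ^ 2) ≤ y ^ 2 := min_le_right _ _
    have hsq : |t - x| ^ 2 = (t - x) ^ 2 := sq_abs _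
    rw [hc]
    nlinarith [abs_nonneg (t - x), sq_nonneg (|t - x| - 1), lt_min one_pos (by positivity : (0:ℝ) < y ^ 2)]
  -- assemble with `rpow`
  have hu : 0 < 1 + |t - x| := by positivity
  have hrpow : (1 + ‖t - x‖) ^ (-(3 / 2 : ℝ)) = Real.sqrt (1 + |t - x|) / (1 + |t - x|) ^ 2 := by
    rw [Real.norm_eq_abs, show (-(3 / 2 : ℝ)) = (1 / 2 : ℝ) + (-2 : ℝ) by norm_num,
      Real.rpow_add hu, Real.rpow_neg hu.le, Real.rpow_two, Real.sqrt_eq_rpow]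
    exact (div_eq_mul_inv _ _).symm
  rw [hrpow]
  calc |Real.log ‖(t : ℂ) - a‖| / ((t - x) ^ 2 + y ^ 2)
      ≤ A * Real.sqrt (1 + |t - x|) / ((t - x) ^ 2 + y ^ 2) :=
        div_le_div_of_nonneg_right hnum (by positivity)
    _ ≤ A * Real.sqrt (1 + |t - x|) / (c * (1 + |t - x|) ^ 2) :=
        div_le_div_of_nonneg_left (by positivity) (by positivity) hden
    _ = A / c * (Real.sqrt (1 + |t - x|) / (1 + |t - x|) ^ 2) := by
        field_simp

/-! ### The case `a = z̄`: `∫ log|t − z̄| dt/((t−x)²+y²) = (π/y) log(2y)` -/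

/-- `∫_ℝ ds/(1 + s²) · log y`-type bookkeeping: `∫_ℝ log(1+s²)/(1+s²)` is integrable. [folklore] -/
private theorem integrable_log_one_add_sq_div :
    Integrable fun s : ℝ ↦ Real.log (1 + s ^ 2) / (1 + s ^ 2) := by
  have h := integrable_log_norm_sub_div (a := -I) (by simp) 0 one_ne_zero
  have h2 := h.const_mul 2
  refine h2.congr (ae_of_all _ fun s ↦ ?_)
  have hn : ‖(s : ℂ) - -I‖ = Real.sqrt (1 + s ^ 2) := by
    rw [sub_neg_eq_add, Complex.norm_def, Complex.normSq_apply]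
    simp
    ring_nf
  simp only [hn, sub_zero, one_pow]
  rw [Real.log_sqrt (by positivity)]
  ring

/-- **The Poisson integral of `log|t − z̄|` at `z`**: for `z = x + iy`, `y > 0`,
`∫_ℝ log|t − z̄| dt/((t − x)² + y²) = (π/y) log(2y)` (here `|t − z̄|² = (t−x)² + y²`; scale
`t = x + ys` and use `∫ log(1+s²)/(1+s²) = 2π log 2`, `∫ ds/(1+s²) = π`).
[cite: Rudin1987, Thm 17.16 (half-plane form)] -/
theorem integral_log_norm_sub_conj_div (x : ℝ) {y : ℝ} (hy : 0 < y) :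
    ∫ t : ℝ, Real.log ‖(t : ℂ) - conj ((x : ℂ) + y * I)‖ / ((t - x) ^ 2 + y ^ 2)
      = π / y * Real.log (2 * y) := by
  have hy0 : y ≠ 0 := hy.ne'
  -- the integrand as a function of `u = t - x`
  set h : ℝ → ℝ := fun u ↦ Real.log (u ^ 2 + y ^ 2) / 2 / (u ^ 2 + y ^ 2) with hh
  have hint : ∀ t : ℝ, Real.log ‖(t : ℂ) - conj ((x : ℂ) + y * I)‖ / ((t - x) ^ 2 + y ^ 2)
      = h (t - x) := by
    intro t
    have hn : ‖(t : ℂ) - conj ((x : ℂ) + y * I)‖ = Real.sqrt ((t - x) ^ 2 + y ^ 2) := by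
      rw [Complex.norm_def, Complex.normSq_apply]
      simp
      ring_nf
    rw [hh, hn, Real.log_sqrt (by positivity)]
  simp_rw [hint]
  rw [integral_sub_right_eq_self h x]
  -- scale `u = y s`
  have hscale : ∫ u : ℝ, h u = y * ∫ s : ℝ, h (y * s) := by
    rw [Measure.integral_comp_mul_left h y, abs_of_pos (inv_pos.2 hy), smul_eq_mul]
    field_simp
  rw [hscale]
  have hys : ∀ s : ℝ, h (y * s) = (y ^ 2)⁻¹ * (Real.log y * (1 + s ^ 2)⁻¹
      + Real.log (1 + s ^ 2) / (1 + s ^ 2) / 2) := by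
    intro s
    have h1 : (y * s) ^ 2 + y ^ 2 = y ^ 2 * (1 + s ^ 2) := by ring
    rw [hh]
    simp only
    rw [h1, Real.log_mul (by positivity) (by positivity), Real.log_pow]
    field_simp
    ring
  simp_rw [hys]
  rw [integral_const_mul, integral_add (integrable_inv_one_add_sq.const_mul _)
      (integrable_log_one_add_sq_div.div_const 2), integral_const_mul, integral_univ_inv_one_add_sq,
    integral_div, integral_log_one_add_sq_div, Real.log_mul two_ne_zero hy0]
  field_simp
  ring

/-! ### One step: the difference formula for `log|t − b| − log|t − c|`, `b` close to `c` -/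

/-- **One-step difference formula.** For `b, c` in the open lower half-plane with
`|c − b| ≤ |Im c|/2` and `z = x + iy`, `y > 0`:
`∫_ℝ (log|t−b| − log|t−c|) dt/((t−x)²+y²) = (π/y)(log|z−b| − log|z−c|)`. Proof: Cauchy's formula
and theorem along `ℝ` (tree `HalfPlaneCauchy`) for `F(w) = log(1 + (c−b)/(w−c))`, holomorphic on
the closed upper half-plane with `|F(w)| ≤ (3/2)|c−b|/|w−c|`, tested against
`1/(t−z) − 1/(t−z̄) = 2iy/((t−x)²+y²)`. [cite: Rudin1987, Thm 17.16 (half-plane form)] -/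
theorem integral_log_norm_sub_sub_div {b c : ℂ} (hb : b.im < 0) (hc : c.im < 0)
    (hbc : ‖c - b‖ ≤ |c.im| / 2) (x : ℝ) {y : ℝ} (hy : 0 < y) :
    ∫ t : ℝ, (Real.log ‖(t : ℂ) - b‖ - Real.log ‖(t : ℂ) - c‖) / ((t - x) ^ 2 + y ^ 2)
      = π / y * (Real.log ‖((x : ℂ) + y * I) - b‖ - Real.log ‖((x : ℂ) + y * I) - c‖) := by
  set z : ℂ := (x : ℂ) + y * I with hz
  have hzim : z.im = y := by simp [hz]
  have hzre : z.re = x := by simp [hz]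
  set m : ℝ := |c.im| with hm
  have hm0 : 0 < m := abs_pos.2 hc.ne
  have hmc : m = -c.im := abs_of_neg hc
  -- the test function
  set u : ℂ → ℂ := fun w ↦ (c - b) / (w - c) with hu
  set F : ℂ → ℂ := fun w ↦ Complex.log (1 + u w) with hF
  -- on the closed upper half-plane: `|w - c| ≥ m`, `|u w| ≤ 1/2`
  have hwc : ∀ w : ℂ, 0 ≤ w.im → m ≤ ‖w - c‖ := by
    intro w hw
    have h1 : |(w - c).im| ≤ ‖w - c‖ := Complex.abs_im_le_norm _
    have h2 : (w - c).im = w.im - c.im := by simp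
    rw [h2] at h1
    have : m ≤ |w.im - c.im| := by rw [hmc, abs_of_pos (by linarith)]; linarith
    exact this.trans h1
  have hwc0 : ∀ w : ℂ, 0 ≤ w.im → w - c ≠ 0 := fun w hw h ↦ by
    have := hwc w hw; rw [h, norm_zero] at this; linarith
  have hun : ∀ w : ℂ, 0 ≤ w.im → ‖u w‖ ≤ ‖c - b‖ / ‖w - c‖ := fun w hw ↦ by
    rw [hu]; simp only; rw [norm_div]
  have huhalf : ∀ w : ℂ, 0 ≤ w.im → ‖u w‖ ≤ 1 / 2 := by
    intro w hw
    refine (hun w hw).trans ?_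
    rw [div_le_iff₀ (hm0.trans_le (hwc w hw))]
    calc ‖c - b‖ ≤ m / 2 := hbc
      _ ≤ 1 / 2 * ‖w - c‖ := by linarith [hwc w hw]
  have hFn : ∀ w : ℂ, 0 ≤ w.im → ‖F w‖ ≤ 3 / 2 * (‖c - b‖ / ‖w - c‖) := fun w hw ↦
    (Complex.norm_log_one_add_half_le_self (huhalf w hw)).trans (by gcongr; exact hun w hw)
  -- differentiability on the closed upper half-plane
  have hd : ∀ w : ℂ, 0 ≤ w.im → DifferentiableAt ℂ F w := by
    intro w hw
    have hu_d : DifferentiableAt ℂ u w := by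
      rw [hu]
      exact (differentiableAt_const _).div (differentiableAt_id.sub_const c) (hwc0 w hw)
    refine ((differentiableAt_const (1 : ℂ)).add hu_d).clog ?_
    exact mem_slitPlane_of_norm_lt_one (by linarith [huhalf w hw])
  -- `‖F‖²` integrable on `ℝ`
  have hi : Integrable fun t : ℝ ↦ ‖F t‖ ^ 2 := by
    have hdom := (integrable_norm_inv_ofReal_sub_sq hc.ne).const_mul ((3 / 2 * ‖c - b‖) ^ 2)
    refine hdom.mono' ?_ (ae_of_all _ fun t ↦ ?_)
    · exact ((aestronglyMeasurable_ofReal_of_differentiableAt hd).norm.pow 2)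
    · rw [Real.norm_eq_abs, abs_of_nonneg (sq_nonneg _)]
      have h := hFn t (by simp)
      have h0 : 0 ≤ ‖F t‖ := norm_nonneg _
      rw [norm_inv]
      calc ‖F ↑t‖ ^ 2 ≤ (3 / 2 * (‖c - b‖ / ‖(t : ℂ) - c‖)) ^ 2 := pow_le_pow_left₀ h0 h 2
        _ = (3 / 2 * ‖c - b‖) ^ 2 * ‖(t : ℂ) - c‖⁻¹ ^ 2 := by ring
  -- decay `‖F w‖ ≤ C/√(Im w)` on the open upper half-plane
  set K : ℝ := max 1 m⁻¹ with hK
  have hb' : ∀ w : ℂ, 0 < w.im → (0 : ℝ) ≤ ‖w‖ → ‖F w‖ ≤ 3 / 2 * ‖c - b‖ * K / Real.sqrt w.im := by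
    intro w hw _
    have hwc' := hwc w hw.le
    have hsqrt : Real.sqrt w.im ≤ K * ‖w - c‖ := by
      rcases le_or_gt 1 w.im with h1 | h1
      · -- `√(Im w) ≤ Im w ≤ |w - c|`
        have hs : Real.sqrt w.im ≤ w.im := by
          rw [Real.sqrt_le_left (by linarith)]
          nlinarith
        have him : w.im ≤ ‖w - c‖ := by
          have := Complex.abs_im_le_norm (w - c)
          have h2 : (w - c).im = w.im - c.im := by simp
          rw [h2, abs_of_pos (by linarith)] at this
          linarith
        calc Real.sqrt w.im ≤ ‖w - c‖ := hs.trans him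
          _ ≤ K * ‖w - c‖ := le_mul_of_one_le_left (norm_nonneg _) (le_max_left _ _)
      · -- `√(Im w) < 1 ≤ |w - c|/m`
        have hs : Real.sqrt w.im ≤ 1 := by
          rw [Real.sqrt_le_one]; exact h1.le
        calc Real.sqrt w.im ≤ 1 := hs
          _ ≤ m⁻¹ * ‖w - c‖ := by
            rw [le_inv_mul_iff₀ hm0]; simpa using hwc'
          _ ≤ K * ‖w - c‖ := mul_le_mul_of_nonneg_right (le_max_right _ _) (norm_nonneg _)
    have hspos : 0 < Real.sqrt w.im := Real.sqrt_pos.2 hw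
    have hwcpos : 0 < ‖w - c‖ := hm0.trans_le hwc'
    calc ‖F w‖ ≤ 3 / 2 * (‖c - b‖ / ‖w - c‖) := hFn w hw.le
      _ = 3 / 2 * ‖c - b‖ / ‖w - c‖ := by ring
      _ ≤ 3 / 2 * ‖c - b‖ * K / Real.sqrt w.im := by
        rw [div_le_div_iff₀ hwcpos hspos]
        have h0 : 0 ≤ 3 / 2 * ‖c - b‖ := by positivity
        nlinarith
  have hC : (0 : ℝ) ≤ 3 / 2 * ‖c - b‖ * K := by positivity
  -- Cauchy along `ℝ`
  have hI1 := integral_div_sub_eq_of_im_pos (R₀ := 0) hC hd hi hb' (w := z) (by rw [hzim]; exact hy)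
  have hI2 := integral_div_sub_eq_zero_of_im_neg (R₀ := 0) hC hd hi hb' (a := conj z)
    (by rw [Complex.conj_im, hzim]; linarith)
  -- subtract: `∫ F(t) (2yi)/((t-x)²+y²) = 2πi F(z)`
  have hFm : AEStronglyMeasurable (fun t : ℝ ↦ F t) volume :=
    aestronglyMeasurable_ofReal_of_differentiableAt hd
  have hint1 : Integrable fun t : ℝ ↦ F t / ((t : ℂ) - z) :=
    integrable_div_ofReal_sub hFm hi (by rw [hzim]; exact hy.ne')
  have hint2 : Integrable fun t : ℝ ↦ F t / ((t : ℂ) - conj z) :=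
    integrable_div_ofReal_sub hFm hi (by rw [Complex.conj_im, hzim]; exact neg_ne_zero.2 hy.ne')
  have hdiff : ∫ t : ℝ, (F t / ((t : ℂ) - z) - F t / ((t : ℂ) - conj z)) = 2 * π * I * F z := by
    rw [integral_sub hint1 hint2, hI1, hI2, sub_zero]
  have hD0 : ∀ t : ℝ, (t - x) ^ 2 + y ^ 2 ≠ 0 := fun t ↦ by positivity
  have h5 : z - conj z = 2 * y * I := by
    rw [Complex.sub_conj, hzim]; push_cast; ring
  have hkernel : ∀ t : ℝ, F t / ((t : ℂ) - z) - F t / ((t : ℂ) - conj z)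
      = (2 * y * I : ℂ) * (F t * ((((t - x) ^ 2 + y ^ 2)⁻¹ : ℝ) : ℂ)) := by
    intro t
    have h1 : (t : ℂ) - z ≠ 0 := fun h ↦ by
      have := congrArg Complex.im h; simp [hzim] at this; exact hy.ne' this
    have h2 : (t : ℂ) - conj z ≠ 0 := fun h ↦ by
      have := congrArg Complex.im h; simp [hzim] at this; exact hy.ne' this
    have h3 : ((t : ℂ) - conj z) * ((t : ℂ) - z) = ((((t - x) ^ 2 + y ^ 2 : ℝ)) : ℂ) := by
      rw [ofReal_sub_conj_mul_ofReal_sub, hzre, hzim]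
    have h4 : ((((t - x) ^ 2 + y ^ 2 : ℝ)) : ℂ) ≠ 0 := by exact_mod_cast hD0 t
    have h6 : ((t : ℂ) - conj z) - ((t : ℂ) - z) = 2 * y * I := by rw [← h5]; ring
    rw [div_sub_div _ _ h1 h2, mul_comm ((t : ℂ) - z) ((t : ℂ) - conj z), h3, Complex.ofReal_inv,
      div_eq_iff h4]
    field_simp
    linear_combination (F t) * h6
  -- the Poisson-type integral of `F`
  set G : ℝ → ℂ := fun t ↦ F t * ((((t - x) ^ 2 + y ^ 2)⁻¹ : ℝ) : ℂ) with hG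
  have hy' : (y : ℂ) ≠ 0 := by exact_mod_cast hy.ne'
  have hyI : (2 * y * I : ℂ) ≠ 0 := mul_ne_zero (mul_ne_zero two_ne_zero hy') I_ne_zero
  have hGint : Integrable G := by
    have h : Integrable (fun t : ℝ ↦ (F t / ((t : ℂ) - z) - F t / ((t : ℂ) - conj z)) / (2 * y * I)) :=
      (hint1.sub hint2).div_const (2 * y * I)
    refine h.congr (ae_of_all _ fun t ↦ ?_)
    simp only [hG]
    rw [hkernel t]
    field_simp
  have hGval : ∫ t : ℝ, G t = (π / y : ℝ) * F z := by
    have h1 : ∫ t : ℝ, (F t / ((t : ℂ) - z) - F t / ((t : ℂ) - conj z))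
        = (2 * y * I : ℂ) * ∫ t : ℝ, G t := by
      rw [← integral_const_mul]
      exact integral_congr_ae (ae_of_all _ fun t ↦ hkernel t)
    rw [h1] at hdiff
    have h2 : ∫ t : ℝ, G t = (2 * π * I * F z) / (2 * y * I) := by
      rw [eq_div_iff hyI, mul_comm]; exact hdiff
    rw [h2]
    push_cast
    field_simp
  -- real parts
  have hb0 : ∀ t : ℝ, (t : ℂ) - b ≠ 0 := fun t h ↦ by
    have := congrArg Complex.im h; simp at this; linarith
  have hc0 : ∀ t : ℝ, (t : ℂ) - c ≠ 0 := fun t ↦ hwc0 t (by simp)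
  have hre_F : ∀ w : ℂ, w - c ≠ 0 → w - b ≠ 0 →
      (F w).re = Real.log ‖w - b‖ - Real.log ‖w - c‖ := by
    intro w hwc hwb
    have h1u : 1 + u w = (w - b) / (w - c) := by
      rw [hu]; field_simp; ring
    rw [hF]
    simp only
    rw [Complex.log_re, h1u, norm_div, Real.log_div (norm_ne_zero_iff.2 hwb) (norm_ne_zero_iff.2 hwc)]
  have hzb : z - b ≠ 0 := fun h ↦ by
    have := congrArg Complex.im h; simp [hzim] at this; linarith
  have hzc : z - c ≠ 0 := hwc0 z (by rw [hzim]; exact hy.le)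
  calc ∫ t : ℝ, (Real.log ‖(t : ℂ) - b‖ - Real.log ‖(t : ℂ) - c‖) / ((t - x) ^ 2 + y ^ 2)
      = ∫ t : ℝ, (G t).re := by
        refine integral_congr_ae (ae_of_all _ fun t ↦ ?_)
        simp only [hG]
        rw [Complex.re_mul_ofReal, hre_F t (hc0 t) (hb0 t), div_eq_mul_inv]
    _ = (∫ t : ℝ, G t).re := by
        have h := integral_re hGint
        simp only [RCLike.re_to_complex] at h
        exact h
    _ = π / y * (Real.log ‖z - b‖ - Real.log ‖z - c‖) := by
        rw [hGval, Complex.re_ofReal_mul, hre_F z hzc hzb]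

/-! ### The Poisson integral of `log|t − a|`, `a` in the lower half-plane -/

/-- **The Poisson integral of `log|t − a|` at `z`**: for `a` in the open lower half-plane and
`z = x + iy` with `y > 0`, `∫_ℝ log|t − a| dt/((t − x)² + y²) = (π/y) log|z − a|`, i.e.
`(y/π)∫ log|t − a| dt/((t−x)²+y²) = log|z − a|`: the harmonic function `log|· − a|` is the Poisson
integral of its boundary values (half-plane form of Rudin's Thm 17.16(a) for the outer function
`w ↦ w − a`). Proof: chain the one-step formula `integral_log_norm_sub_sub_div` along the segment
from `a` to `z̄` and use `integral_log_norm_sub_conj_div`. [cite: Rudin1987, Thm 17.16 (half-plane form)] -/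
theorem integral_log_norm_sub_div {a : ℂ} (ha : a.im < 0) (x : ℝ) {y : ℝ} (hy : 0 < y) :
    ∫ t : ℝ, Real.log ‖(t : ℂ) - a‖ / ((t - x) ^ 2 + y ^ 2)
      = π / y * Real.log ‖((x : ℂ) + y * I) - a‖ := by
  set z : ℂ := (x : ℂ) + y * I with hz
  have hzim : z.im = y := by simp [hz]
  have hczim : (conj z).im = -y := by rw [Complex.conj_im, hzim]
  -- step count along the segment from `a` to `conj z`
  set m₀ : ℝ := min (-a.im) y with hm₀
  have hm₀pos : 0 < m₀ := lt_min (by linarith) hy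
  have hm₀a : m₀ ≤ -a.im := min_le_left _ _
  have hm₀y : m₀ ≤ y := min_le_right _ _
  obtain ⟨n, hn⟩ : ∃ n : ℕ, 2 * ‖conj z - a‖ / m₀ ≤ n := exists_nat_ge _
  set N : ℕ := n + 1 with hN
  have hNpos : (0 : ℝ) < N := by positivity
  have hNge : 2 * ‖conj z - a‖ / m₀ ≤ N := hn.trans (by simp [hN])
  have hstep : ‖conj z - a‖ / N ≤ m₀ / 2 := by
    rw [div_le_iff₀ hNpos]
    have := (div_le_iff₀ hm₀pos).1 hNge
    linarith
  -- the points `p k = a + (k/N)(conj z − a)`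
  set p : ℕ → ℂ := fun k ↦ a + ((k : ℝ) / N : ℝ) * (conj z - a) with hp
  have hp0 : p 0 = a := by simp [hp]
  have hpN : p N = conj z := by
    have : ((N : ℝ) / N : ℝ) = 1 := div_self hNpos.ne'
    simp only [hp, this]; push_cast; ring
  have hpim : ∀ k : ℕ, (p k).im = a.im + (k : ℝ) / N * (-y - a.im) := by
    intro k
    simp only [hp, add_im, mul_im, ofReal_re, ofReal_im, sub_im, hczim, zero_mul, add_zero]
  have hpim_le : ∀ k : ℕ, k ≤ N → (p k).im ≤ -m₀ := by
    intro k hk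
    rw [hpim]
    have h0 : 0 ≤ (k : ℝ) / N := by positivity
    have h1 : (k : ℝ) / N ≤ 1 := by
      rw [div_le_one hNpos]; exact_mod_cast hk
    nlinarith
  have hpim_neg : ∀ k : ℕ, k ≤ N → (p k).im < 0 := fun k hk ↦ by
    linarith [hpim_le k hk]
  have hpdiff : ∀ k : ℕ, ‖p (k + 1) - p k‖ = ‖conj z - a‖ / N := by
    intro k
    have : p (k + 1) - p k = (((1 : ℝ) / N : ℝ) : ℂ) * (conj z - a) := by
      simp only [hp]; push_cast; ring
    rw [this, norm_mul, Complex.norm_real, Real.norm_eq_abs, abs_of_pos (by positivity)]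
    ring
  -- integrals and logarithms along the chain
  set Ik : ℕ → ℝ := fun k ↦ ∫ t : ℝ, Real.log ‖(t : ℂ) - p k‖ / ((t - x) ^ 2 + y ^ 2) with hIk
  set Lk : ℕ → ℝ := fun k ↦ Real.log ‖z - p k‖ with hLk
  have hchain : ∀ k : ℕ, k ≤ N → Ik 0 - Ik k = π / y * (Lk 0 - Lk k) := by
    intro k
    induction k with
    | zero => intro _; simp
    | succ k ih =>
      intro hk
      have hk' : k ≤ N := Nat.le_of_succ_le hk
      have hb : (p k).im < 0 := hpim_neg k hk'
      have hc : (p (k + 1)).im < 0 := hpim_neg (k + 1) hk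
      have hbc : ‖p (k + 1) - p k‖ ≤ |(p (k + 1)).im| / 2 := by
        rw [hpdiff, abs_of_neg hc]
        have := hpim_le (k + 1) hk
        linarith
      have hone := integral_log_norm_sub_sub_div hb hc hbc x hy
      have hsub : Ik k - Ik (k + 1)
          = ∫ t : ℝ, (Real.log ‖(t : ℂ) - p k‖ - Real.log ‖(t : ℂ) - p (k + 1)‖)
              / ((t - x) ^ 2 + y ^ 2) := by
        simp only [hIk]
        rw [← integral_sub (integrable_log_norm_sub_div hb.ne x hy.ne')
          (integrable_log_norm_sub_div hc.ne x hy.ne')]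
        refine integral_congr_ae (ae_of_all _ fun t ↦ ?_)
        simp only [sub_div]
      have := ih hk'
      simp only [hLk] at this ⊢
      rw [← hz] at hone
      linarith [hsub, hone]
  have hfin := hchain N le_rfl
  -- evaluate the `k = N` terms: `p N = conj z`
  have hIN : Ik N = π / y * Real.log (2 * y) := by
    simp only [hIk, hpN, hz]
    exact integral_log_norm_sub_conj_div x hy
  have hLN : Lk N = Real.log (2 * y) := by
    simp only [hLk, hpN]
    rw [Complex.sub_conj, hzim, norm_mul, Complex.norm_real, Complex.norm_I, mul_one,
      Real.norm_eq_abs, abs_of_pos (by positivity)]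
  have hI0 : Ik 0 = ∫ t : ℝ, Real.log ‖(t : ℂ) - a‖ / ((t - x) ^ 2 + y ^ 2) := by
    simp only [hIk, hp0]
  have hL0 : Lk 0 = Real.log ‖z - a‖ := by simp only [hLk, hp0]
  rw [hIN, hLN, hI0, hL0] at hfin
  rw [hz] at hfin ⊢
  linarith

end Literature.Analysis.DeBrangesSpaces

end
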